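import Summits.SmoothPoincare4.Statement
import Literature.Topology.FourManifolds.HomotopySpheres
import Literature.Topology.FourManifolds.ConnectedSum
import Literature.Topology.FourManifolds.SmoothOrientation
import Literature.Topology.FourManifolds.CorkTwist
import Literature.Topology.FourManifolds.Cobordism

/-!
# SmoothPoincare4 / Stabilisation — assemblies

Problem `SmoothPoincare4`, topic `Stabilisation` (route Stabilisation, positive side). Two pieces of
glue, both bookkeeping:

* `stab_assembly` settles stmt-SmoothPoincare4-0449: given the packaging facts (a smooth 4-manifold
  homotopy equivalent to `S⁴` is compact, resp. orientable), "one `S²×S²` stabilisation suffices"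
  (S1) and "one-summand cancellation" (S2) imply `SmoothPoincare4` — S2 ∘ S1 gives every
  `HomotopySphere 4` diffeomorphic to `S⁴`, then package as in `PIC/Reduction`.
* `stab_cork_assembly` settles stmt-SmoothPoincare4-0479: the cork decomposition fact
  (`Literature.Topology.FourManifolds.corkDecomposition`, Matveyev 1996 / Curtis–Freedman–Hsiang–Stong 1996), `Θ₄ = 0` in the
  h-cobordism sense (Kervaire–Milnor 1963 / Wall 1964), homotopy invariance of simple connectivity,
  and the cork crux (every cork twist of `S⁴` is `S⁴`) give every `HomotopySphere 4` diffeomorphic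
  to `S⁴`: decompose the h-cobordism `Σ ~ S⁴` as a cork twist and twist back with
  `Literature.Topology.FourManifolds.IsCorkTwist.symm`.
-/

open scoped Manifold ContDiff
open ContinuousMap

namespace Literature.SPC4

/-- Settles stmt-SmoothPoincare4-0449 (assembly v2 of route Stabilisation): (homotopy `S⁴` ⇒ compact) →
(homotopy `S⁴` ⇒ orientable) → (S1 ∧ S2) → `SmoothPoincare4`, where S1 = every homotopy 4-sphere
becomes `S²×S²` after one connected sum with `S²×S²` and S2 = one-summand cancellation. [folklore] -/
theorem stab_assembly :
    (∀ (M : Type) [TopologicalSpace M] [T2Space M] [SecondCountableTopology M] [ChartedSpace (EuclideanSpace ℝ (Fin 4)) M] [IsManifold (𝓡 4) ∞ M], M ≃ₕ Metric.sphere (0 : EuclideanSpace ℝ (Fin 5)) 1 → CompactSpace M) → (∀ (M : Type) [TopologicalSpace M] [T2Space M] [SecondCountableTopology M] [ChartedSpace (EuclideanSpace ℝ (Fin 4)) M] [IsManifold (𝓡 4) ∞ M], M ≃ₕ Metric.sphere (0 : EuclideanSpace ℝ (Fin 5)) 1 → Literature.Topology.FourManifolds.IsOrientable (𝓡 4) M)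 → ((∀ S : Literature.Topology.FourManifolds.HomotopySphere 4, ∃ (P : Type) (_ : TopologicalSpace P) (_ : ChartedSpace (EuclideanSpace ℝ (Fin 4)) P) (_ : IsManifold (𝓡 4) ∞ P), Literature.Topology.FourManifolds.IsConnectedSum (𝓡 4) (𝓡 4) ((𝓡 2).prod (𝓡 2)) S.carrier (Metric.sphere (0 : EuclideanSpace ℝ (Fin 3)) 1 × Metric.sphere (0 : EuclideanSpace ℝ (Fin 3)) 1) P ∧ Nonempty (P ≃ₘ⟮𝓡 4, (𝓡 2).prod (𝓡 2)⟯ (Metric.sphere (0 : EuclideanSpace ℝ (Fin 3)) 1 × Metric.sphere (0 : EuclideanSpace ℝ (Fin 3)) 1))) ∧ (∀ S : Literature.Topology.FourManifolds.HomotopySphere 4, (∃ (P : Type) (_ : TopologicalSpace P) (_ : ChartedSpace (EuclideanSpace ℝ (Fin 4)) P) (_ : IsManifold (𝓡 4) ∞ P), Literature.Topology.FourManifolds.IsConnectedSum (𝓡 4) (𝓡 4) ((𝓡 2).prod (𝓡 2)) S.carrier (Metric.sphere (0 : EuclideanSpace ℝ (Fin 3)) 1 × Metric.sphere (0 : EuclideanSpace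 ℝ (Fin 3)) 1) P ∧ Nonempty (P ≃ₘ⟮𝓡 4, (𝓡 2).prod (𝓡 2)⟯ (Metric.sphere (0 : EuclideanSpace ℝ (Fin 3)) 1 × Metric.sphere (0 : EuclideanSpace ℝ (Fin 3)) 1))) → Nonempty (S.carrier ≃ₘ⟮𝓡 4, 𝓡 4⟯ Metric.sphere (0 : EuclideanSpace ℝ (Fin 5)) 1))) → SmoothPoincare4 := by
  intro hC hO h M _ _ _ cs im e
  haveI : CompactSpace M := hC M e
  obtain ⟨o⟩ := hO M e
  exact h.2 ⟨M, o, ⟨e⟩⟩ (h.1 ⟨M, o, ⟨e⟩⟩)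

/-- Settles stmt-SmoothPoincare4-0479 (cork-branch assembly of route Stabilisation):
`Literature.Topology.FourManifolds.corkDecomposition` → (every homotopy 4-sphere is h-cobordant to `S⁴`) → (homotopy `S⁴` ⇒ simply
connected) → (every cork twist of `S⁴` along a compact contractible `C` is diffeomorphic to `S⁴`) →
every `HomotopySphere 4` is diffeomorphic to `S⁴`. [folklore] -/
theorem stab_cork_assembly :
    Literature.Topology.FourManifolds.corkDecomposition.{0} → (∀ S : Literature.Topology.FourManifolds.HomotopySphere 4, Literature.Topology.FourManifolds.IsHCobordant 4 S.carrier (Metric.sphere (0 : EuclideanSpace ℝ (Fin 5)) 1)) → (∀ (M : Type) [TopologicalSpace M], M ≃ₕ Metric.sphere (0 : EuclideanSpace ℝ (Fin 5)) 1 → SimplyConnectedSpace M) → (∀ (C : Type) [TopologicalSpace C] [T2Space C] [SecondCountableTopology C] [ChartedSpace (EuclideanHalfSpace 4) C] [IsManifold (𝓡∂ 4) ∞ C] [CompactSpace C] [ContractibleSpace C] (bC : Literature.Topology.FourManifolds.BoundaryData (𝓡∂ 4) C (𝓡 3)) (τ : bC.carrier ≃ₘ⟮𝓡 3, 𝓡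 3⟯ bC.carrier) (X : Type) [TopologicalSpace X] [T2Space X] [SecondCountableTopology X] [ChartedSpace (EuclideanSpace ℝ (Fin 4)) X] [IsManifold (𝓡 4) ∞ X], Literature.Topology.FourManifolds.IsCorkTwist bC τ (𝓡 4) (Metric.sphere (0 : EuclideanSpace ℝ (Fin 5)) 1) (𝓡 4) X → Nonempty (X ≃ₘ⟮𝓡 4, 𝓡 4⟯ Metric.sphere (0 : EuclideanSpace ℝ (Fin 5)) 1)) → ∀ S : Literature.Topology.FourManifolds.HomotopySphere 4, Nonempty (S.carrier ≃ₘ⟮𝓡 4, 𝓡 4⟯ Metric.sphere (0 : EuclideanSpace ℝ (Fin 5)) 1) := by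
  intro hD hΘ hSC hC4 S
  obtain ⟨e⟩ := S.nonempty_homotopyEquiv
  haveI := hSC S.carrier e
  haveI : SimplyConnectedSpace (Metric.sphere (0 : EuclideanSpace ℝ (Fin 5)) 1) :=
    hSC _ (ContinuousMap.HomotopyEquiv.refl _)
  obtain ⟨C, _, _, _, _, _, bC, τ, hCc, hCo, hT⟩ :=
    hD S.carrier (Metric.sphere (0 : EuclideanSpace ℝ (Fin 5)) 1) (hΘ S)
  haveI := hCc
  haveI := hCo
  exact hC4 C bC τ.symm S.carrier hT.symm

end Literature.SPC4
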